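import Mathlib
import HarnessLib
import Summits.RiemannHypothesis.RiemannHypothesis.Theorems.IntegerScrewHarmonicStates

/-!
# Route `IntegerScrew` — `h̃` and `h′` under the five move types of the walk (CONTINUUM-LIMIT 16.4, «DERIVATION»)

The exact decomposition 16.4 of `(𝒜_D − ∂_u)h̃` starts from how the comparison functions change under the walk's
moves («Births of a new prime q … change (ρ, Π, W) to (ρ−θ_q, Πφ(θ_q), Ww_q); of q^a, a ≥ 2, q ∤ x, to
(ρ−aθ_q, Πφ(θ_q), Ww_q); of p^a with p ∣ x to (ρ−aθ_p, Π, W); a partial death p^b, b < v_p … to (ρ+bθ_p, Π, W);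
the full death b = v_p to (ρ+v_pθ_p, Π/φ(θ_p), W/w_p)»).  With `IntegerScrewWalkStates` (room and prime-set
bookkeeping) these become the following identities for `hTilde L u x = K(u,ρ_x)·Π(u;x)` and
`hPrime = hTilde·W` (`θ_q = log q/L`, `φ(θ) = 1 − e^{−uθ}`, `w_q = q/(q−1)`):

* `hTilde_mul_new` / `hPrime_mul_new` (new prime power `q^a`, `q ∤ x`, `a ≥ 1`);
* `hTilde_mul_present` / `hPrime_mul_present` (`p ∣ x`);
* `hTilde_div_partial` / `hPrime_div_partial` (`b < v_p(x)`);
* `hTilde_ordCompl_mul` / `hPrime_ordCompl_mul` (full death, stated multiplicatively).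

Algebra only; RH-free.  Nothing here bears on the truth of RH.  References: CONTINUUM-LIMIT §16.2, §16.4
(rh-explicit); M. Suzuki, J. Lond. Math. Soc. (2) 108 (2023) 1448–1487 [Suzuki2023].
-/

noncomputable section

-- D-0017: `Summit.<S>.<S>.…` is the designed namespace of a single-problem summit.
set_option linter.dupNamespace false

namespace Summit.RiemannHypothesis.RiemannHypothesis.Theorems.IntegerScrew

open Finset

/-- NEW prime power `q^a` (`q ∤ x`, `a ≥ 1`): `h̃(u; x·q^a) = K(u, ρ_x − aθ_q)·Π(u;x)·φ(θ_q)`. -/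
theorem hTilde_mul_new (L u : ℝ) {x q a : ℕ} (hx : x ≠ 0) (hq : q.Prime) (hqx : ¬ q ∣ x) (ha : a ≠ 0) :
    hTilde L u (x * q ^ a) =
      ccpK u (room L x - a * (Real.log q / L)) * primeProd L u x * (1 - Real.exp (-(u * (Real.log q / L)))) := by
  unfold hTilde
  rw [room_mul_prime_pow L hx hq.ne_zero a, primeProd_mul_of_not_dvd L u hx hq hqx ha, mul_assoc]

/-- NEW prime power: `h′(u; x·q^a) = K(u, ρ_x − aθ_q)·Π(u;x)·φ(θ_q)·W(x)·q/(q−1)`. -/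
theorem hPrime_mul_new (L u : ℝ) {x q a : ℕ} (hx : x ≠ 0) (hq : q.Prime) (hqx : ¬ q ∣ x) (ha : a ≠ 0) :
    hPrime L u (x * q ^ a) =
      ccpK u (room L x - a * (Real.log q / L)) * primeProd L u x * (1 - Real.exp (-(u * (Real.log q / L)))) *
        (wProd x * ((q : ℝ) / ((q : ℝ) - 1))) := by
  unfold hPrime
  rw [hTilde_mul_new L u hx hq hqx ha, wProd_mul_of_not_dvd hx hq hqx ha]

/-- PRESENT prime power `p^a` (`p ∣ x`): `h̃(u; x·p^a) = K(u, ρ_x − aθ_p)·Π(u;x)`. -/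
theorem hTilde_mul_present (L u : ℝ) {x p : ℕ} (hx : x ≠ 0) (hp : p.Prime) (hpx : p ∣ x) (a : ℕ) :
    hTilde L u (x * p ^ a) = ccpK u (room L x - a * (Real.log p / L)) * primeProd L u x := by
  unfold hTilde
  rw [room_mul_prime_pow L hx hp.ne_zero a, primeProd_mul_of_dvd L u hx hp hpx a]

/-- PRESENT prime power: `h′(u; x·p^a) = K(u, ρ_x − aθ_p)·Π(u;x)·W(x)`. -/
theorem hPrime_mul_present (L u : ℝ) {x p : ℕ} (hx : x ≠ 0) (hp : p.Prime) (hpx : p ∣ x) (a : ℕ) :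
    hPrime L u (x * p ^ a) = ccpK u (room L x - a * (Real.log p / L)) * primeProd L u x * wProd x := by
  unfold hPrime
  rw [hTilde_mul_present L u hx hp hpx a, wProd_mul_of_dvd hx hp hpx a]

/-- PARTIAL death `x → x/p^b`, `b < v_p(x)`: `h̃(u; x/p^b) = K(u, ρ_x + bθ_p)·Π(u;x)`. -/
theorem hTilde_div_partial (L u : ℝ) {x p b : ℕ} (hx : x ≠ 0) (hp : p.Prime) (hb : b < x.factorization p) :
    hTilde L u (x / p ^ b) = ccpK u (room L x + b * (Real.log p / L)) * primeProd L u x := by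
  unfold hTilde
  rw [room_div_prime_pow L hx ((hp.pow_dvd_iff_le_factorization hx).2 hb.le), primeProd_div_of_lt L u hx hp hb]

/-- PARTIAL death: `h′(u; x/p^b) = K(u, ρ_x + bθ_p)·Π(u;x)·W(x)`. -/
theorem hPrime_div_partial (L u : ℝ) {x p b : ℕ} (hx : x ≠ 0) (hp : p.Prime) (hb : b < x.factorization p) :
    hPrime L u (x / p ^ b) = ccpK u (room L x + b * (Real.log p / L)) * primeProd L u x * wProd x := by
  unfold hPrime
  rw [hTilde_div_partial L u hx hp hb, wProd_div_of_lt hx hp hb]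

/-- FULL death `x → x/p^{v_p(x)}` (`p ∣ x`), multiplicatively:
`h̃(u; x/p^{v})·φ(θ_p) = K(u, ρ_x + vθ_p)·Π(u;x)`, `v = v_p(x)`. -/
theorem hTilde_ordCompl_mul (L u : ℝ) {x p : ℕ} (hx : x ≠ 0) (hp : p.Prime) (hpx : p ∣ x) :
    hTilde L u (x / p ^ x.factorization p) * (1 - Real.exp (-(u * (Real.log p / L)))) =
      ccpK u (room L x + x.factorization p * (Real.log p / L)) * primeProd L u x := by
  unfold hTilde
  rw [room_div_prime_pow L hx (Nat.ordProj_dvd x p), mul_assoc, ← primeProd_eq_ordCompl_mul L u hx hp hpx]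

/-- FULL death, multiplicatively for `h′`:
`h′(u; x/p^{v})·φ(θ_p)·p/(p−1) = K(u, ρ_x + vθ_p)·Π(u;x)·W(x)`. -/
theorem hPrime_ordCompl_mul (L u : ℝ) {x p : ℕ} (hx : x ≠ 0) (hp : p.Prime) (hpx : p ∣ x) :
    hPrime L u (x / p ^ x.factorization p) * (1 - Real.exp (-(u * (Real.log p / L)))) *
        ((p : ℝ) / ((p : ℝ) - 1)) =
      ccpK u (room L x + x.factorization p * (Real.log p / L)) * primeProd L u x * wProd x := by
  rw [← hTilde_ordCompl_mul L u hx hp hpx, wProd_eq_ordCompl_mul hx hp hpx]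
  unfold hPrime
  ring

end Summit.RiemannHypothesis.RiemannHypothesis.Theorems.IntegerScrew

end
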